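import Mathlib
import HarnessLib
import Summits.PneNP.PneNP.Theorems.CnfIdealGenLengthRankDefectRepresentationsTwoFamilyStability

/-!
# The cut lemma IS the one-generator extension step of rank-stability (line rank-dehn-ladder, stub `stub_cutLemma`)

Crux `stmt-PneNP-18923` (`Summit.PneNP.PneNP.Theses.CnfIdealGenLength.RankDefectRepresentations`), line
`rank-dehn-ladder`, negative rung N1 (`stub_cutLemma`, OPEN).  This file proves, kernel-checked, that the cut lemma (over
fields of characteristic `0`) is EQUIVALENT — with the same exponent and constants changed by a factor `55` — to the
ONE-STEP EXTENSION form of rank-stability: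

  (EXT)  if `E_1, …, E_n` are pairwise commuting idempotents written in a common eigenbasis (diagonal `0/1` matrices, i.e. a
         colouring `c : Fin d → {0,1}^n` of the basis) and `X` is an idempotent whose every coordinate cut
         `X ∘ 1[c(x)_j ≠ c(y)_j]` (`= ±[E_j, X]` entrywise) has rank `≤ t`, then there is an IDEMPOTENT `X'` commuting with
         every `E_j` (i.e. supported on equal-colour pairs) with `rank (X − X') ≤ C (n+1)^a · t`.

* `ext_of_cutLemma`  — cut lemma (char 0) ⟹ (EXT): apply the cut lemma to the square instance `row = col = c`, `R = X`, then
  re-idempotise the colour-diagonal approximant INSIDE the commutant of the colour classes with the landed `K^{b+1}`-stability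
  theorem `…TwoFamilyStability.orthogonalFamily_stable_commuting` (p614956; re-indexed here to an arbitrary finite index type);
  constant `55·C`.
* `cutLemma_of_ext` — (EXT) ⟹ cut lemma (char 0): a rectangular instance `R` (rows coloured by `row`, columns by `col`) embeds
  as the idempotent `X = [[1, R], [0, 0]]` on `ι ⊕ ι'` with colouring `row ⊔ col`; its cuts are the cuts of `R` padded by zeros,
  an idempotent `X'` supported on equal colours restricts to the wanted `R'` (its `(ι, ι')` block), and
  `rank (R − R') ≤ rank (X − X')`; same constants.

So the negative rung N1 is exactly what any generator-by-generator proof of `stub_uniformStability` needs at its last step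
("extend a commuting `(n−1)`-tuple by one more almost-commuting idempotent at polynomial cost"), and conversely such a step
proves N1.  What is NOT claimed: the compounding of these steps over `n` generators (each step perturbs the earlier generators,
`Lines/rank-dehn-ladder-NOL.md` §5(f)) — that is the open `many-family` problem; (EXT) iterated naively only reproduces the
finite constants of `…FiniteStability` (p618152).
HONEST FRAMING: elementary linear algebra about one rung; the cut lemma stays open; P ≠ NP is not moved; F-N2 is a FRONTIER
formal rung.
-/

set_option linter.dupNamespace false -- `Summit.PneNP.PneNP.…`: summit = sub-problem name (D-0017)

namespace Summit.PneNP.PneNP.Theorems.CnfIdealGenLengthRankDefectRepresentationsCutLemmaExtension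

open Finset
open Literature.Computability.AlgebraicComplexity (rank_add_le)
open Summit.PneNP.PneNP.Theorems.CnfIdealGenLengthRankDefectRepresentationsTseitinTransfer (rk_neg rk_sub)
open Summit.PneNP.PneNP.Theorems.CnfIdealGenLengthRankDefectRepresentationsTwoFamilyStability
  (orthogonalFamily_stable_commuting)

variable {K : Type} [Field K]

/-! ## `K^{b+1}`-stability inside a commutant, over an arbitrary finite index type -/

/-- `orthogonalFamily_stable_commuting` (p614956) with the exact family `P` indexed by any nonempty finite type. -/
theorem orthogonalFamily_stable_commuting_fintype [CharZero K] {d : ℕ} {κ : Type} [Fintype κ] [Nonempty κ]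
    (P : κ → Matrix (Fin d) (Fin d) K)
    (hP : ∀ k, P k * P k = P k) (hPorth : ∀ k l, k ≠ l → P k * P l = 0) (hPsum : ∑ k, P k = 1)
    {b : ℕ} (r : Fin (b + 1) → Matrix (Fin d) (Fin d) K) (s : ℕ)
    (hidem : ∀ l, (r l * r l - r l).rank ≤ s) (horth : ∀ l m, l ≠ m → (r l * r m).rank ≤ s)
    (hone : (∑ l, r l - 1).rank ≤ s) (hcomm : ∀ k l, P k * r l = r l * P k) :
    ∃ Q : Fin (b + 1) → Matrix (Fin d) (Fin d) K,
      (∀ l, Q l * Q l = Q l) ∧ (∀ l m, l ≠ m → Q l * Q m = 0) ∧ (∑ l, Q l = 1) ∧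
      (∀ k l, P k * Q l = Q l * P k) ∧ ∀ m, (Q m - r m).rank ≤ 3 * (b + 2) ^ 2 * s := by
  classical
  obtain ⟨a, ha⟩ : ∃ a, Fintype.card κ = a + 1 := Nat.exists_eq_succ_of_ne_zero Fintype.card_ne_zero
  let e : κ ≃ Fin (a + 1) := (Fintype.equivFin κ).trans (finCongr ha)
  have hsum' : ∑ k, P (e.symm k) = 1 := by rw [← hPsum]; exact e.symm.sum_comp P
  obtain ⟨Q, h1, h2, h3, h4, h5⟩ := orthogonalFamily_stable_commuting (fun k => P (e.symm k)) (fun k => hP _)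
    (fun k l hkl => hPorth _ _ (e.symm.injective.ne hkl)) hsum' r s hidem horth hone (fun k l => hcomm _ _)
  refine ⟨Q, h1, h2, h3, fun k l => ?_, h5⟩
  have := h4 (e k) l
  simpa using this

/-! ## Colour-class projections -/

section ColourClasses

variable {d n : ℕ} (c : Fin d → Fin n → Bool)

/-- Left multiplication by the colour-class projection `P_σ = diag 1[c x = σ]` keeps the rows of colour `σ`. -/
theorem classProj_mul_apply (σ : Fin n → Bool) (M : Matrix (Fin d) (Fin d) K) (x y : Fin d) :
    (Matrix.diagonal (fun z => if c z = σ then (1 : K) else 0) * M) x y = if c x = σ then M x y else 0 := by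
  rw [Matrix.diagonal_mul]
  split_ifs <;> simp

/-- Right multiplication by `P_σ` keeps the columns of colour `σ`. -/
theorem mul_classProj_apply (σ : Fin n → Bool) (M : Matrix (Fin d) (Fin d) K) (x y : Fin d) :
    (M * Matrix.diagonal (fun z => if c z = σ then (1 : K) else 0)) x y = if c y = σ then M x y else 0 := by
  rw [Matrix.mul_diagonal]
  split_ifs <;> simp

/-- `P_σ` is idempotent. -/
theorem classProj_idem (σ : Fin n → Bool) :
    Matrix.diagonal (fun z => if c z = σ then (1 : K) else 0) * Matrix.diagonal (fun z => if c z = σ then (1 : K) else 0) =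
      Matrix.diagonal (fun z => if c z = σ then (1 : K) else 0) := by
  rw [Matrix.diagonal_mul_diagonal]
  congr 1
  funext z
  split_ifs <;> simp

/-- Distinct colour classes are orthogonal. -/
theorem classProj_orth {σ τ : Fin n → Bool} (h : σ ≠ τ) :
    Matrix.diagonal (fun z => if c z = σ then (1 : K) else 0) * Matrix.diagonal (fun z => if c z = τ then (1 : K) else 0) = 0 := by
  rw [Matrix.diagonal_mul_diagonal, ← Matrix.diagonal_zero]
  congr 1
  funext z
  by_cases h1 : c z = σ
  · simp [h1, h]
  · simp [h1]

/-- The colour classes sum to the identity. -/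
theorem sum_classProj :
    ∑ σ : Fin n → Bool, Matrix.diagonal (fun z => if c z = σ then (1 : K) else 0) = (1 : Matrix (Fin d) (Fin d) K) := by
  ext x y
  rw [Matrix.sum_apply]
  simp only [Matrix.diagonal_apply, Matrix.one_apply]
  by_cases hxy : x = y
  · subst hxy
    simp
  · simp [hxy]

/-- A matrix supported on equal-colour pairs commutes with every colour class. -/
theorem classProj_comm_of_support (M : Matrix (Fin d) (Fin d) K) (hM : ∀ x y, c x ≠ c y → M x y = 0)
    (σ : Fin n → Bool) :
    Matrix.diagonal (fun z => if c z = σ then (1 : K) else 0) * M = M * Matrix.diagonal (fun z => if c z = σ then (1 : K) else 0) := by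
  ext x y
  rw [classProj_mul_apply, mul_classProj_apply]
  by_cases hxy : c x = c y
  · rw [hxy]
  · rw [hM x y hxy]; simp

/-- Conversely, a matrix commuting with every colour class is supported on equal-colour pairs. -/
theorem support_of_classProj_comm (M : Matrix (Fin d) (Fin d) K)
    (hM : ∀ σ : Fin n → Bool, Matrix.diagonal (fun z => if c z = σ then (1 : K) else 0) * M =
      M * Matrix.diagonal (fun z => if c z = σ then (1 : K) else 0)) (x y : Fin d) (hxy : c x ≠ c y) : M x y = 0 := by
  have h := congrFun (congrFun (hM (c x)) x) y
  rw [classProj_mul_apply, mul_classProj_apply, if_pos rfl, if_neg (Ne.symm hxy)] at h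
  exact h

end ColourClasses

/-! ## Cut lemma (char 0) ⟹ one-step extension -/

/-- **Cut lemma ⟹ (EXT).**  If the cut lemma holds over fields of characteristic `0` with constants `(C, a)`, then every
idempotent `X` whose coordinate cuts for a basis colouring `c` have rank `≤ t` is within rank `55·C·(n+1)^a·t` of an
IDEMPOTENT supported on equal-colour pairs (equivalently: commuting with the diagonal colour idempotents). -/
theorem ext_of_cutLemma
    (hCL : ∃ C a : ℕ, ∀ (K : Type) [Field K] [CharZero K] (n : ℕ) (ι ι' : Type) [Fintype ι] [Fintype ι']
      (row : ι → Fin n → Bool) (col : ι' → Fin n → Bool) (t : ℕ) (R : Matrix ι ι' K),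
      (∀ j : Fin n, (Matrix.of fun x y => if row x j ≠ col y j then R x y else 0).rank ≤ t) →
        ∃ R' : Matrix ι ι' K, (∀ x y, row x ≠ col y → R' x y = 0) ∧ (R - R').rank ≤ C * (n + 1) ^ a * t) :
    ∃ C a : ℕ, ∀ (K : Type) [Field K] [CharZero K] (n d : ℕ) (c : Fin d → Fin n → Bool) (t : ℕ)
      (X : Matrix (Fin d) (Fin d) K), X * X = X →
      (∀ j : Fin n, (Matrix.of fun x y => if c x j ≠ c y j then X x y else 0).rank ≤ t) →
        ∃ X' : Matrix (Fin d) (Fin d) K, X' * X' = X' ∧ (∀ x y, c x ≠ c y → X' x y = 0) ∧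
          (X - X').rank ≤ 55 * C * (n + 1) ^ a * t := by
  obtain ⟨C, a, hCL⟩ := hCL
  refine ⟨C, a, fun K _ _ n d c t X hX hcut => ?_⟩
  classical
  obtain ⟨R', hsupp, hdist⟩ := hCL K n (Fin d) (Fin d) c c t X hcut
  set s : ℕ := C * (n + 1) ^ a * t with hs
  set P : (Fin n → Bool) → Matrix (Fin d) (Fin d) K :=
    fun σ => Matrix.diagonal fun z => if c z = σ then (1 : K) else 0 with hP_def
  have hP : ∀ σ, P σ * P σ = P σ := fun σ => classProj_idem c σ
  have hPorth : ∀ σ τ, σ ≠ τ → P σ * P τ = 0 := fun σ τ h => classProj_orth c h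
  have hPsum : ∑ σ, P σ = 1 := sum_classProj c
  -- defects of the colour-diagonal approximant `R'`
  set Δ : Matrix (Fin d) (Fin d) K := X - R' with hΔ
  have hΔr : Δ.rank ≤ s := hdist
  have hR' : R' = X - Δ := by rw [hΔ]; abel
  have hdef : (R' * R' - R').rank ≤ 2 * s := by
    have e1 : R' * R' - R' = -(X * Δ) + Δ * (Δ + 1 - X) := by
      have e2 : R' * R' - R' = X * X - X - X * Δ + Δ * (Δ + 1 - X) := by rw [hR']; noncomm_ring
      rw [e2, hX]; abel
    rw [e1]
    refine (rank_add_le _ _).trans ?_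
    rw [rk_neg]
    have r1 := Matrix.rank_mul_le_right X Δ
    have r2 := Matrix.rank_mul_le_left Δ (Δ + 1 - X)
    omega
  -- the family `(1 - R', R')`
  set r : Fin 2 → Matrix (Fin d) (Fin d) K := ![1 - R', R'] with hr_def
  have hr0 : r 0 = 1 - R' := rfl
  have hr1 : r 1 = R' := rfl
  have hidem : ∀ l, (r l * r l - r l).rank ≤ 2 * s := by
    intro l
    fin_cases l
    · show ((1 - R') * (1 - R') - (1 - R')).rank ≤ 2 * s
      have e1 : (1 - R') * (1 - R') - (1 - R') = R' * R' - R' := by noncomm_ring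
      rw [e1]; exact hdef
    · exact hdef
  have horth : ∀ l m, l ≠ m → (r l * r m).rank ≤ 2 * s := by
    intro l m hlm
    fin_cases l <;> fin_cases m
    · exact absurd rfl hlm
    · show ((1 - R') * R').rank ≤ 2 * s
      have e1 : (1 - R') * R' = -(R' * R' - R') := by noncomm_ring
      rw [e1, rk_neg]; exact hdef
    · show (R' * (1 - R')).rank ≤ 2 * s
      have e1 : R' * (1 - R') = -(R' * R' - R') := by noncomm_ring
      rw [e1, rk_neg]; exact hdef
    · exact absurd rfl hlm
  have hone : (∑ l, r l - 1).rank ≤ 2 * s := by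
    rw [Fin.sum_univ_two, hr0, hr1, sub_add_cancel, sub_self, Matrix.rank_zero]; exact Nat.zero_le _
  have hcomm : ∀ σ l, P σ * r l = r l * P σ := by
    intro σ l
    have hc : P σ * R' = R' * P σ := classProj_comm_of_support c R' hsupp σ
    fin_cases l
    · show P σ * (1 - R') = (1 - R') * P σ
      rw [mul_sub, sub_mul, mul_one, one_mul, hc]
    · exact hc
  haveI : Nonempty (Fin n → Bool) := ⟨fun _ => false⟩
  obtain ⟨Q, hQ1, -, -, hQcomm, hQdist⟩ :=
    orthogonalFamily_stable_commuting_fintype P hP hPorth hPsum r (2 * s) hidem horth hone hcomm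
  refine ⟨Q 1, hQ1 1, fun x y hxy => support_of_classProj_comm c (Q 1) (fun σ => hQcomm σ 1) x y hxy, ?_⟩
  have e1 : X - Q 1 = Δ + -(Q 1 - r 1) := by rw [hr1, hΔ]; abel
  rw [e1]
  refine (rank_add_le _ _).trans ?_
  rw [rk_neg]
  have h2 := hQdist 1
  have : s + 3 * (1 + 2) ^ 2 * (2 * s) = 55 * C * (n + 1) ^ a * t := by rw [hs]; ring
  rw [← this]
  exact Nat.add_le_add hΔr h2

/-! ## One-step extension ⟹ cut lemma (char 0) -/

/-- Zero-padding a block does not increase rank: `rank [[0, B], [0, 0]] ≤ rank B`. [folklore] -/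
theorem rank_fromBlocks_zero₁₂_le {ι ι' : Type} [Fintype ι] [Fintype ι'] [DecidableEq ι] [DecidableEq ι']
    (B : Matrix ι ι' K) :
    (Matrix.fromBlocks (0 : Matrix ι ι K) B (0 : Matrix ι' ι K) (0 : Matrix ι' ι' K)).rank ≤ B.rank := by
  have h : Matrix.fromBlocks (0 : Matrix ι ι K) B (0 : Matrix ι' ι K) (0 : Matrix ι' ι' K) =
      (Matrix.of fun (x : ι ⊕ ι') (a : ι) => if x = Sum.inl a then (1 : K) else 0) * B *
        (Matrix.of fun (b : ι') (y : ι ⊕ ι') => if y = Sum.inr b then (1 : K) else 0) := by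
    ext x y
    rcases x with x | x <;> rcases y with y | y <;>
      simp [Matrix.mul_apply, Finset.sum_ite_eq]
  rw [h]
  exact (Matrix.rank_mul_le_left _ _).trans (Matrix.rank_mul_le_right _ _)

/-- **(EXT) ⟹ cut lemma.**  If the one-step extension statement holds with constants `(C, a)`, then so does the cut
lemma over fields of characteristic `0`, with the same constants: embed `R` as the idempotent `[[1, R], [0, 0]]`. -/
theorem cutLemma_of_ext
    (hE : ∃ C a : ℕ, ∀ (K : Type) [Field K] [CharZero K] (n d : ℕ) (c : Fin d → Fin n → Bool) (t : ℕ)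
      (X : Matrix (Fin d) (Fin d) K), X * X = X →
      (∀ j : Fin n, (Matrix.of fun x y => if c x j ≠ c y j then X x y else 0).rank ≤ t) →
        ∃ X' : Matrix (Fin d) (Fin d) K, X' * X' = X' ∧ (∀ x y, c x ≠ c y → X' x y = 0) ∧
          (X - X').rank ≤ C * (n + 1) ^ a * t) :
    ∃ C a : ℕ, ∀ (K : Type) [Field K] [CharZero K] (n : ℕ) (ι ι' : Type) [Fintype ι] [Fintype ι']
      (row : ι → Fin n → Bool) (col : ι' → Fin n → Bool) (t : ℕ) (R : Matrix ι ι' K),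
      (∀ j : Fin n, (Matrix.of fun x y => if row x j ≠ col y j then R x y else 0).rank ≤ t) →
        ∃ R' : Matrix ι ι' K, (∀ x y, row x ≠ col y → R' x y = 0) ∧ (R - R').rank ≤ C * (n + 1) ^ a * t := by
  obtain ⟨C, a, hE⟩ := hE
  refine ⟨C, a, fun K _ _ n ι ι' _ _ row col t R hcut => ?_⟩
  classical
  -- the square instance on `ι ⊕ ι'`, reindexed to `Fin d`
  set d : ℕ := Fintype.card (ι ⊕ ι') with hd
  set e : ι ⊕ ι' ≃ Fin d := Fintype.equivFin (ι ⊕ ι') with he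
  set c₀ : ι ⊕ ι' → Fin n → Bool := Sum.elim row col with hc₀
  set X₀ : Matrix (ι ⊕ ι') (ι ⊕ ι') K := Matrix.fromBlocks (1 : Matrix ι ι K) R 0 (0 : Matrix ι' ι' K) with hX₀
  set X : Matrix (Fin d) (Fin d) K := X₀.submatrix e.symm e.symm with hXd
  set c : Fin d → Fin n → Bool := fun z => c₀ (e.symm z) with hc
  have hX₀sq : X₀ * X₀ = X₀ := by
    rw [hX₀, Matrix.fromBlocks_multiply]
    simp
  have hX : X * X = X := by
    rw [hXd, Matrix.submatrix_mul_equiv, hX₀sq]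
  -- cuts of the square instance are the zero-padded cuts of `R`
  have hcut₀ : ∀ j : Fin n,
      (Matrix.of fun x y => if c₀ x j ≠ c₀ y j then X₀ x y else 0) =
        Matrix.fromBlocks (0 : Matrix ι ι K) (Matrix.of fun x y => if row x j ≠ col y j then R x y else 0)
          (0 : Matrix ι' ι K) (0 : Matrix ι' ι' K) := by
    intro j
    ext x y
    rcases x with x | x <;> rcases y with y | y
    · simp only [Matrix.of_apply, hc₀, Sum.elim_inl, hX₀, Matrix.fromBlocks_apply₁₁, Matrix.one_apply,
        Matrix.zero_apply]
      by_cases hxy : x = y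
      · subst hxy; simp
      · simp [hxy]
    · simp [hc₀, hX₀]
    · simp [hc₀, hX₀]
    · simp [hc₀, hX₀]
  have hcutX : ∀ j : Fin n, (Matrix.of fun x y => if c x j ≠ c y j then X x y else 0).rank ≤ t := by
    intro j
    have e1 : (Matrix.of fun x y => if c x j ≠ c y j then X x y else 0) =
        (Matrix.of fun x y => if c₀ x j ≠ c₀ y j then X₀ x y else 0).submatrix e.symm e.symm := by
      ext x y
      simp [hXd, hc, Matrix.submatrix_apply]
    rw [e1, Matrix.rank_submatrix, hcut₀ j]
    exact (rank_fromBlocks_zero₁₂_le _).trans (hcut j)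
  obtain ⟨X', hX'1, hX'supp, hX'dist⟩ := hE K n d c t X hX hcutX
  -- pull back and restrict to the `(ι, ι')` block
  set X₀' : Matrix (ι ⊕ ι') (ι ⊕ ι') K := X'.submatrix e e with hX₀'
  refine ⟨Matrix.of fun x y => X₀' (Sum.inl x) (Sum.inr y), fun x y hxy => ?_, ?_⟩
  · show X' (e (Sum.inl x)) (e (Sum.inr y)) = 0
    apply hX'supp
    simpa [hc, hc₀] using hxy
  · have e1 : (R - Matrix.of fun x y => X₀' (Sum.inl x) (Sum.inr y)) = (X₀ - X₀').submatrix Sum.inl Sum.inr := by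
      ext x y
      simp [hX₀, hX₀', Matrix.submatrix_apply]
    have e2 : X₀ - X₀' = (X - X').submatrix e e := by
      ext x y
      simp [hXd, hX₀', Matrix.submatrix_apply]
    rw [e1, e2]
    refine (Matrix.rank_submatrix_le _ _ _).trans ?_
    rw [Matrix.rank_submatrix]
    exact hX'dist

end Summit.PneNP.PneNP.Theorems.CnfIdealGenLengthRankDefectRepresentationsCutLemmaExtension
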